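import Mathlib
import HarnessLib
import HarnessLib.Audit
import Summits.ResolutionOfSingularities.Statement
import HarnessLib.Audit.Status.Attr

/-!
Route: ShadowGame

CLOSED (refuted) 2026-08-20T16:19:00Z by gate — reason: refuted:stmt-ResolutionOfSingularities-18182 (ShadowGameWinR) by Summit.ResolutionOfSingularities.ResolutionOfSingularities.Theorems.not_ShadowGameWinR — note: repair grace of 72.0 h (deadline 2026-08-20T16:17:51Z) expired without a repair — closed by the gate. The file is kept as the record of this route; refuted decls are indexed as negative knowledge (`ledger negatives`).

# Route ShadowGame — synthesise a shadow-measurable winning strategy in the alpha_p-torsor blow-up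
game, terminal whistle blown modulo formal re-parametrisation — a machine-certifiable kangaroo
controller

Operator computational-witness, REPAIRED (rev 3, 2026-08-17: the rev-2 spine ShadowGameWin was
refuted-misstated, see Kill criteria).
It suffices to show X = G′ ∧ S′ ∧ T ∧ P ∧ D, whose spine is ONE statement G′ = ShadowGameWinR (rank
2): in the α_p-TORSOR
BASE-BLOW-UP GAME SG^R_p(n) player A (the resolver) has a winning strategy that reads only the
history of SHADOWS. Positions, moves
and observable are those of rev 2: a position is a formal series a = Σ c_A u^A in n variables over a
perfect field κ of
characteristic p (the equation Z^p = a over a regular local ring with exceptional-adapted parameters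
u), CLEANED (monomials with
exponent in pℕ^n deleted); its SHADOW is conv(supp(clean a)/p + ℝ^n_≥0); A chooses a non-empty set F
of coordinates (centre
V(u_j : j ∈ F)); B (nature / the valuation) chooses the chart i ∈ F and a translation τ; the
position becomes
clean(translate_τ(divide_i(blowup_F,i(clean a)))). NEW TERMINAL WHISTLE (the only change): A WINS at
a position when the cleaned
series is 0, has a degree-1 monomial, has a unique minimal exponent (rev-2 clauses, in B's
coordinates) OR — invariantly — when
clean a = w^A·v + g^p in κ⟦u⟧ for some FORMAL regular system of parameters w (n series generating
the maximal ideal), an exponent A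
with some A_j prime to p, a unit v and a series g: the position is a monomial times a unit up to
formal re-parametrisation and
subtraction of p-th powers, i.e. Z^p = a is étale-locally the toric Z^p = w^A, finished outside the
game by log blow-ups. A stays
shadow-measurable; only the referee's whistle reads coefficients. S′ = WinToTorsorLUR (rank 3): G′ ⇒
local uniformization of
α_p-torsors over bases regular at the centre, over PERFECT ground fields (TorsorLUPerfect, the
target, rank 0 = Valuative's
LuAlphaPTorsor stmt-0641 with [PerfectField k]). T = TorsorToLurelPerfect (rank 5), P =
PatchingRelPerfect (rank 4), D =
DescentPerfectToAll (rank 6, stmt-0549 shared) unchanged. The refuted ShadowGameWin survives as the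
route's negative record (negatives index:
`ShadowGameShadowGameWin_refuted` @ 906734155c3f, Theorems/ShadowGameWin/Negative/*) and the rev-2
soundness item WinToTorsorLU =
ShadowGameWin → TorsorLUPerfect, vacuous after the refutation (`winToTorsorLU_iff_true`), is
superseded 1:1 by WinToTorsorLUR. Cards
realised: repair-hironaka-hard-polyhedra-game (spine), transition-invariant-certificates.
Lean: `ShadowGameWinR ∧ WinToTorsorLUR ∧ TorsorToLurelPerfect ∧ PatchingRelPerfect ∧
DescentPerfectToAll`

## Assembly
Pure logic (certified sorry-free in Sketch.lean / glue.lean, `closes` axioms propext ·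
Classical.choice · Quot.sound): fix p prime;
WinToTorsorLUR applied to ShadowGameWinR gives TorsorLUPerfect; at p, TorsorToLurelPerfect turns it
into relative LU over perfect k,
PatchingRelPerfect into resolution over perfect k, DescentPerfectToAll into ResolutionInChar p; the
summit is ∀ p, p.Prime →
ResolutionInChar p by definition. `closes hW hS hT hP hD := fun p hp => hD p hp (hP p hp (hT p hp
(hS hW p hp)))`.

Rationale: WHY THIS LINE. Hironaka proved (c. 1977; Spivakovsky1982 p.1009) that a winning strategy for A in
his HARD polyhedra game implies local
uniformization in every characteristic; Spivakovsky1982 showed B wins the abstract game for n = 3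
and asked for modified rules with
a winning strategy; since CossartPiltant2019 proved LU in dimension 3 that B-win is an artefact of
the abstraction, and nobody
repaired it. The lever: on the degree-p α_p-torsor class — the whole summit by the in-tree/Temkin
reductions, at height e = 1
where Moh1987's stability holds and HauserPerlega2019's unbounded residual order (e ≥ 3) does not
occur — CLEANING IS ADDITIVE, so
nature's moves on the shadow are exactly Lucas-children of support points plus cancellations
(Kollar2007 3.74.6 as a digit rule);
stating the game SEMANTICALLY (one real series evolves; A sees shadows) makes soundness bookkeeping
and turns the open content into
a REACTIVE-SYNTHESIS problem (find A's strategy; verify (strategy, ranking) pairs by decision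
procedures where definable in Büchi
arithmetic; Berczi2026 = arXiv:2602.06553 searches rankings for a FIXED process only). REV 3: the
rev-2 whistle, blown in B's
coordinates, was beaten at n = 2 by B following a smooth non-coordinate arc (Z^p = u·w^p,
uniformized by Z/w; tree:
ShadowGameShadowGameWin_refuted, Negative/EveryDim `shadowGame_won_iff`, Disproof CurveFamily
`curve_trap`) — a defect of the
whistle, not of the move alphabet (with τ = 0 for ever the play is the toric Euclid algorithm and
terminates). The repaired whistle
is the class-invariant one (a mod p-th powers = the exact 1-form da): terminal′ iff da = w^(A−1)·η
with w formal snc parameters and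
η non-vanishing or with non-degenerate linear part; at n = 2 "divide fully, then blow up the point"
is then expected to win
(HauserWagner2014 Thm 1, arXiv:1403.6789 p.8: point blow-ups make f mod p-th powers monomial in
subordinate coordinates or drop the
order below p; Giraud1983 normal forms), and the refuters' window search found no R1-cycle at n = 2
(Cruxes/WinToTorsorLU/Disproof
§6(d)). Imported areas unchanged: infinite reachability games / reactive synthesis, termination
certificates, automatic
structures; plus Artin approximation for the formal-to-étale passage in the soundness crux. No
listed route has a game, a
synthesised strategy, or a coefficient-free shadow calculus (Valuative: valuation-theoretic;
WeightedInvariant/MarkedTransfer: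
invariants and global centres; RadicialJung: cleans the differential da globally — the nearest
neighbour of the new whistle, which
reads da only locally and only as a stopping rule).

RANKED CRUXES. #0 TorsorLUPerfect (target) — local uniformization of α_p-torsors over bases regular
at the centre, over PERFECT ground fields: k perfect of char p, K/k, O a valuation ring of K, A₀ ⊆ O
f.g. regular at the centre, t ∈ K with t^p ∈ A₀ and Frac(A₀[t]) = K ⇒ some f.g. A with A₀[t] ⊆ A ⊆
O, Frac A = K, A regular at the centre (Valuative's LuAlphaPTorsor, stmt-0641, with [PerfectField k]
added). Derived in `closes` as WinToTorsorLUR applied to ShadowGameWinR. (why it might fail: It is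
Temkin2013 Rem 1.3.5's 'uniformize valuations on α_p-torsors over regular schemes', open for dim ≥ 4
in every p (CutkoskyMourtada2019 §1: ELU unknown in dim 4); fails iff LU fails over some perfect
field.) [Temkin2013, CutkoskyMourtada2019, CossartPiltant2019,
Literature.Barriers.ResolutionOfSingularities.DimensionFourFrontier]
#2 ShadowGameWinR (crux) — THE CERTIFICATE, REPAIRED (rev 3 = rev-2 ShadowGameWin with the refuters'
R1 whistle). For every prime p and n ≥ 1 there is a strategy strat (input: the list of shadows seen
so far and the list of charts B chose; output: a non-empty F ⊆ {1..n}) such that for every perfect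
field κ of char p, every start series c₀ : ℕ^n → κ, every chart sequence i and translation sequence
t of B, the play c_{m+1} = clean(translate_{t m}(divide_{i m}(blowup_{F_m, i m}(clean c_m)))) with
F_m = strat(history) reaches a TERMINAL′ series at some finite stage whenever B always plays i m ∈
F_m; blowup/divide/translate/clean/shadow verbatim as in rev 2 (blowup_{F,i}: u_j ↦ u_i u_j for j ∈
F∖i; divide_i by u_i^(p⌊m_F/p⌋); translate u_j ↦ u_j + τ_j on F∖i with Lucas binomials; clean
deletes exponents in pℕ^n). TERMINAL′(c): clean c = 0, or clean c has a monomial of degree ≤ 1, or a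
unique minimal exponent, OR there are w : Fin n → κ⟦u⟧ with Ideal.span(range w) = the maximal ideal
of κ⟦u⟧ (a formal regular system of parameters), A : Fin n → ℕ with some p ∤ A_j, a unit v and a
series g of κ⟦u⟧ with clean c = (∏ w_j^{A_j})·v + g^p coefficientwise. Every tree witness against
rev 2 (u·(v−φ(u))^p along any arc; the (3,2) 6-cycle ≡ (1+u)³w² mod cubes) is terminal′ at stage 0;
positions with da free of divisorial zeros and degenerate linear part (x³y+xy⁵ at p = 2, xy(x+y) at
p ≠ 3) are not, so the game has content from n = 2 on. [difficulty: open-problem] (why it might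
fail: A reads only shadows in B's coordinates: at n = 3 B may hide which stratum is due
(Spivakovsky1982-type B-win re-run against the new whistle); at n = 2 a B-arc might keep da
divisor-free and degenerate for ever; n ≥ 4: realisable kangaroo cycles (HauserPerlega2019).)
[Spivakovsky1982, HauserWagner2014, arXiv:1403.6789, Giraud1983, Giraud1983Jung, HauserPerlega2019,
CossartPiltant2019, Hironaka1967, Moh1987, Hauser2008Kangaroo, CossartJannsenSaito2020, Berczi2026]
#3 WinToTorsorLUR (crux) — SOUNDNESS + ENDGAME for the repaired game: ShadowGameWinR ⇒
TorsorLUPerfect. Dictionary as in rev 2 (reduce to zero-dimensional valuations centred at a REGULAR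
closed point of V(centre) — Reg(A₀) open, Jacobson; residue fields algebraic over the perfect k
hence perfect; Cohen coefficient fields containing k unique and compatible along the separable
residue tower, all embedded in one algebraic closure κ; the expansion of a = t^p in
exceptional-adapted parameters evolves exactly by `step`: blow up (u_F) on a f.g. model after
inverting a unit of O, divide Z by u_i^k inside O, translate by Teichmüller lifts; formal vs
algebraic parameters differ by units, preserving shadows and the three old clauses). NEW endgame
input: a terminal′ position clean a = w^A·v + g^p with w FORMAL parameters over κ ⊇ residue field is
algebraised — strong approximation descends it to the completed strict henselisation, Artin
approximation (Artin1969) to an étale neighbourhood of the centre where a ≡ w′^A v′ mod p-th powers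
with w′ an algebraic regular system of parameters; absorbing the unit (p ∤ A_j) makes Z^p = a
étale-locally the toric Z^p = w′^A, and LU along the valuation follows by log blow-ups (Kato1994
(10.4), Niziol2006 Thm 5.8); ord-1 and clean = 0 exits as in rev 2; every intermediate ring is f.g.
and inside O. [deps: ShadowGameWinR] [difficulty: L] (why it might fail: The whistle's formal
coordinates must be algebraised: Artin approximation gives only ÉTALE-local toric structure
(conjugate formal branches through the centre, node-type cofactors), and the étale-toroidal
log-blow-up endgame over non-closed residue fields may leak, forcing a stricter terminal′.)
[Artin1969, Kato1994, Niziol2006, Spivakovsky1982, Hironaka1967, CossartJannsenSaito2020,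
Temkin2013, NovacoskiSpivakovsky2014]
#4 PatchingRelPerfect (crux) — Zariski patching over PERFECT ground fields: for every prime p,
relative local uniformization (every f.g. R ⊆ O is dominated by a f.g. A ⊆ O with Frac A = K,
regular at the centre) for all f.g. K/k with k perfect of char p implies that every reduced
separated scheme of finite type over every perfect field of char p has a resolution. Fibrewise
identical to Valuative's PatchingRel (stmt-0642) restricted to perfect k — one patching argument
proves both. [difficulty: open-problem] (why it might fail: Patching LUs into one proper regular
model is known only in dim ≤ 3 (Zariski; CossartPiltant2008 Prop 4.9 / Piltant2013 need embedded
resolution one dimension down); in dim ≥ 4 no reduction Res ⇐ LU exists even in char 0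
(CutkoskyMourtada2019 p.3); plain relative LU may be too weak an input.) [CutkoskyMourtada2019,
Temkin2013, CossartPiltant2019, NovacoskiSpivakovsky2014,
Literature.Barriers.ResolutionOfSingularities.DimensionFourFrontier]
#5 TorsorToLurelPerfect (crux) — Temkin's inseparable reduction over PERFECT ground fields: for
every prime p, LU of α_p-torsors over bases regular at the centre (TorsorLUPerfect at p) implies
relative LU for every f.g. K/k, k perfect of char p (Temkin2013 Thm 1.3.2: after a finite purely
inseparable L/K an affine model is uniformized with smooth centre; Frobenius F^n moves it into K (k
perfect, so k^{p^n} = k and the transport is finite); the tower K₀ ⊂ … ⊂ K of degree-p radical steps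
is climbed by the torsor crux). Valuative's TorsorToLurel (stmt-10968) is the all-k version.
[difficulty: L] (why it might fail: Rests on Temkin2013 Thm 1.3.2 (vendored fact with an unproved
leaf in tree: Temkin2013RelativeCurveSmoothFibre) and on Temkin's model dominating the GIVEN R,
which needs his relative form; smooth ≠ regular bookkeeping at each tower step.) [Temkin2013,
arXiv:0804.1554, Literature.AlgebraicGeometry.Resolution.Temkin2013Relative,
Literature.Barriers.ResolutionOfSingularities.InseparableBaseChange]
#6 DescentPerfectToAll (crux) — perfect fields ⇒ all fields (shared verbatim with routes Descent /
WeightedInvariant / UniformComplexity / CleanCovers / MarkedTransfer, stmt-0549): for a prime p,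
resolution of all reduced separated finite-type schemes over all PERFECT fields of char p implies
ResolutionInChar p. [difficulty: open-problem] (why it might fail: Only known mechanism spreads X
over a f.g. field of definition and base-changes a resolution over a perfect subfield back; regular
is not geometrically regular under inseparable extension (EGA IV 6.7.4), e.g. k = F_p((t))
(Temkin2008 Question 3.3.3 open).) [arXiv:math/0703678, Kollar2007,
Literature.Barriers.ResolutionOfSingularities.InseparableBaseChange,
Literature.Barriers.ResolutionOfSingularities.RegularNotGeometricallyRegular]

TWO-LAYER PLAN. Foreseen glued splits, filed only after a census. ShadowGameWinR ⇐ SGR_two (n = 2: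
"divide fully, then blow up the point" wins —
expected from HauserWagner2014 Thm 1 for the order-p regime plus embedded resolution of the
divisorial part of da along the valuation
for the order-< p tail; the rev-2 stub SG_le3 is DEAD as typed, `not_SG_le3`) → SGR_step (a uniform
strategy template for all n with
a digit-sensitive ranking, verified per (p, n); n = 3 calibrated against CossartPiltant2019 and
against Spivakovsky1982's B-strategy
re-run under the new whistle) → ShadowGameWinR. WinToTorsorLUR ⇐ Dictionary (real
blow-up/division/translation steps = `step` on
expansions; the registered rev-2 line Lines/birth.lean: stub_reduction, stub_dictionary survive
re-pointing) → Algebraize′ (terminal′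
with formal w ⇒ étale-locally toric: Artin approximation; replaces stub_algebraize clause (2), cf.
Cruxes/WinToTorsorLU/Disproof §6(b))
→ Endgame (étale-toroidal ⇒ LU via log blow-ups) → WinToTorsorLUR.

KILL CRITERIA. (i) A REALISABLE B-win in SG^R_p(n) for some n ≥ 4 (one explicit series over F_p-bar
and a chart/translation rule beating every A,
positions certified non-terminal′) is a candidate counterexample to LU: attach it, close nothing,
alert Valuative. (ii) REPAIR COUNT:
rev 2's ShadowGameWin fell to kill criterion (ii) (B-win at n = 2 against the coordinate-bound
whistle; refuted-misstated; repair 1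
of the ≤ 2 allowed = this rev 3). A B-win against ShadowGameWinR for n ≤ 3 (necessarily a defect of
shadow-measurability or of the
coordinate-stratum move alphabet, since LU holds there and the whistle is now invariant) ⇒ close
`refuted:ShadowGameWinR` — no third
whistle; the surviving idea (synthesised controller) goes back to the card with the evidence. (iii)
¬PatchingRelPerfect or
¬DescentPerfectToAll proved ⇒ the whole LU family (Valuative, CyclicCovers, this) is dead at that
node; close `superseded`/`refuted`
with them. (iv) LuAlphaPTorsor (stmt-0641) proved by Valuative's provers moots ranks 2–3 here (close
`superseded --by
route-ResolutionOfSingularities-Valuative`). (v) WinToTorsorLUR shown to need a stricter terminal′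
(étale-vs-Zariski leak) ⇒ restate
the whistle once inside the same repair budget only if ShadowGameWinR is untouched by it; else
close.

NOT DECOMPOSED YET. The move alphabet stays deliberately minimal (coordinate-stratum centres,
maximal u_i-division, no re-parametrisation MOVE for A, no
weighted centres): rev 3 changed only the stopping rule. The exact terminality TEST on polynomial
windows (sufficient certificate of
non-terminality: clean ≠ 0, no degree-1 monomial, degenerate quadratic part, gcd(a_x, a_y, …)
without factor through the centre;
sufficient certificate of terminality: explicit (w, A, v, g) found by completing p-th powers along
the divisorial part of da) is
left to the compute/refuter seat; the ranking/verification format likewise. Imperfect ground fields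
are routed through
DescentPerfectToAll. No global (canonical, functorial) version of the game is filed: patching stays
a separate crux.

CHEAPEST FALSIFIER. Run SG^R_p(2), p ∈ {2, 3, 5}, A = "divide fully along every coordinate, then
blow up the point", B over translations in F_p ∪
{generic}, on the window 'exponents ≤ 4p, ≤ 6 support points', depth ≤ 12, with the two certificates
of `Not decomposed yet` as the
terminal′ oracle (undecided states logged, not counted): any certified B-cycle or certified
divergent arc at n = 2 kills rev 3
(kill criterion (ii)); the refuters' first pass (Cruxes/WinToTorsorLU/Disproof §6(d): 1627 / 5198 /
81192 starts at p = 2 / 3 / 5,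
longest certified-non-terminal′ run 8 / 3 / 2 moves, no cycle) found none. Then re-run
Spivakovsky1982 §II's n = 3 B-strategy
against the repaired whistle by hand (one afternoon). Done this session: all tree traps (period-1
u((1−u)v−u)^p every p, the (3,2)
6-cycle, every arc u(v−φ(u))^p) are terminal′ at stage 0; x³y + xy⁵ (p = 2) is certified
non-terminal′ and is an A-win in one move.

NUMBERS. Known A-wins of the COARSER one-sided game: n ≤ 2 (Hironaka, quoted in Spivakovsky1982
p.1010); B-win of the one-sided game: n =
3, N = 3 (Spivakovsky1982 §II). Rev-2 game: A wins SG_p(n) iff n = 1 (tree, `shadowGame_won_iff`).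
Geometric truth: resolution in
dim ≤ 3 (CossartPiltant2019 Thm 1.1), so SG^R_p(n) 'should' be an A-win for n ≤ 3 if shadows suffice
to steer. Purely inseparable
surfaces x^p + F(y,z): point blow-ups monomialize f mod p-th powers or drop the order below p
(HauserWagner2014 Thm 1). Moh's bound
at e = 1: residual order rises by at most 1 per kangaroo (Moh1987; Hauser2008Kangaroo §B). Items
after repair: 7 active (target, 5 cruxes,
assembly) + 2 replaced records (ShadowGameWin refuted → ShadowGameWinR; WinToTorsorLU vacuous →
WinToTorsorLUR).

DEFINITION REQUESTS. None: the game is inlined (`let`-bound move generator + terminal′ over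
Mathlib's MvPowerSeries / IsLocalRing.maximalIdeal / IsUnit;
elaborates, Sketch.lean rc 0). If provers want it factored, a definition item `TorsorShadowStep` /
`TerminalModFormal` under
Summits/ResolutionOfSingularities/ResolutionOfSingularities/Theorems can be filed and the crux
re-pointed by `set-signature` without
changing its meaning (the tree's Negative/Mirror.lean already names the rev-2 generator).

Novelty: Searches (2026-08-16, rev 2): `lit search --source s2 "Hironaka polyhedra game Spivakovsky
counterexample"` (3); `lit read doi:10.2977/prims/1195183292` (full); `lit read arXiv:2602.06553`
pp.1–3; `lit galaxy search "polyhedra game" --star all` (6); `lit galaxy search "kangaroo" --star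
pdf` (0 relevant); all 15 open route files; cards repair-hironaka-hard-polyhedra-game,
transition-invariant-certificates, hydra-wqo-termination, adversary-mining-losing-set,
certify-monsters, tropical-schoen-certificates. (2026-08-17, rev 3): `lit read arxiv:1403.6789
--grep 'quasi-monomial|Theorem 1'` (Thm 1 p.8, quasi-monomial p.10, read); references.bib keys
HauserWagner2014, Giraud1983, Giraud1983Jung, Abhyankar1956 confirmed; tree read:
Theorems/ShadowGameShadowGameWinRefutation.lean, Theorems/ShadowGameWin/Negative/*,
Cruxes/ShadowGameWin/Disproof.lean (repair analysis), Cruxes/WinToTorsorLU/Disproof.lean §§5–7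
(repair outlook, dichotomy); `ledger negatives` for the summit.
Nearest prior art found: Spivakovsky1982 / Hironaka's hard polyhedra game (one-sided additions, B
wins n = 3, abandoned); HauserWagner2014 (arXiv:1403.6789, Thm 1: at n = 2 point blow-ups
monomialize f mod p-th powers in subordinate coordinates — nearly the repaired crux at n = 2, with
an invariant instead of a game and no valuation adversary); Berczi2026 (arXiv:2602.06553:
evolutionary search of ranking functions for a fixed canonical process); Giraud1983 / Giraud1983Jung
(normal forms of a function mod p-th powers on  [refs: 10.2977/prims/1195183292`, 2602.06553, 1403.6789, doi:10.2977/prims/1195183292, arxiv:1403.6789, HauserWagner2014, Giraud1983, Abhyankar1956, Spivakovsky1982, Berczi2026]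

Barriers (technique_class: resolution-game strategy-synthesis alpha-p-torsor): - technique_class: resolution-game strategy-synthesis alpha-p-torsor
- Literature.Barriers.ResolutionOfSingularities.Hauser2003_kangarooShadeIncrease: evaded in
currency, not denied: no hypersurface of maximal contact, no coefficient ideal, no lexicographic
(order, shade) invariant is posited; A's ranking may be any well-founded, history-dependent function
of shadows, and the division move partially normalises at each step — Hauser's kangaroo start
position is an A-win in two moves.
- Literature.Barriers.ResolutionOfSingularities.hauserPerlega_mohProofBoundFails: Hauser–Perlega's
divergence needs height e ≥ 3 (z^(p^e)); the route lives at e = 1 (degree-p torsors, by Temkin's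
tower), where Moh's stability holds; their point-only centre rule is one B-favourable line of SG^R,
not A's strategy (A may take larger coordinate strata, which 'would prevent the phenomenon').
- Literature.Barriers.ResolutionOfSingularities.DimensionFourFrontier: it applies — ShadowGameWinR
for n ≥ 4 and PatchingRelPerfect are open exactly there; the bet is that the torsor shadow game is
dimension-uniform combinatorics whose strategy can be found by machine where no invariant was found
by hand.
- Literature.Barriers.ResolutionOfSingularities.DirectrixSmallCharacteristicNarrow: not used — no
directrix/near-point confinement (CJS Thm 3.14) enters; centres are coordinate strata chosen from
the shadow.
- Literature.Barriers.ResolutionOfSingularities.Narasimhan1983_noSmoothHypersurfaceThroughTopLocus: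
not use

History (route lifecycle, newest last):
- 2026-08-17T12:40:47Z · BROKEN — ShadowGameWin (stmt-ResolutionOfSingularities-16159, crux) refuted by Summit.ResolutionOfSingularities.ResolutionOfSingularities.Theorems.ShadowGameShadowGameWin_refuted @ 906734155c3f (refuter-rattack-stmt-ResolutionOfSingularities-16160-0)
- 2026-08-17T13:32:44Z · rev 3: restated ShadowGameWin (stmt-ResolutionOfSingularities-16159 refuted), WinToTorsorLU (stmt-ResolutionOfSingularities-16160), Assembly (stmt-ResolutionOfSingularities-16163) — repair (rev 3, route-repair rfix-ResolutionOfSingularities-Shado-cc874aa9): ShadowGameWin (stmt-16159, crux r2) refuted-MISSTATED by Theor (planner-rfix-ResolutionOfSingularities-Shado-cc874aa9-0)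
- 2026-08-17T13:32:45Z · REPAIRED (restate ShadowGameWin, WinToTorsorLU, Assembly) — back to open: repair (rev 3, route-repair rfix-ResolutionOfSingularities-Shado-cc874aa9): ShadowGameWin (stmt-16159, crux r2) refuted-MISSTATED by Theorems/ShadowGameShadowGa (planner-rfix-ResolutionOfSingularities-Shado-cc874aa9-0)
- 2026-08-17T13:34:54Z · rev 3: dropped stmt-ResolutionOfSingularities-18183 — rev-3 repair follow-up (same seat): WinToTorsorLUR (stmt-18183) came out of the repair edit with kind 'aside' through a gate internal error (KeyError: 'aside' — (planner-rfix-ResolutionOfSingularities-Shado-cc874aa9-0)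
- 2026-08-17T16:17:51Z · BROKEN — ShadowGameWinR (stmt-ResolutionOfSingularities-18182, crux) refuted by Summit.ResolutionOfSingularities.ResolutionOfSingularities.Theorems.not_ShadowGameWinR @ a3edb04da008 (prover-line-stmt-ResolutionOfSingularities-18182-0)
- 2026-08-20T16:19:02Z · CLOSED refuted — refuted:stmt-ResolutionOfSingularities-18182 (ShadowGameWinR) by Summit.ResolutionOfSingularities.ResolutionOfSingularities.Theorems.not_ShadowGameWinR (grace expired, auto-close) (gate)

sub-problem: ResolutionOfSingularities · status: closed(refuted) · opened planner-plan-novel-ResolutionOfSingularities-Re-dc19aa3a-d-v2-g4-0 2026-08-16T17:46:09Z · rev 3 · ledger route-ResolutionOfSingularities-ShadowGame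
GENERATED by the gate from the ledger (D-0016/17). Provers cite these decls: `theorem foo : Summit.ResolutionOfSingularities.ResolutionOfSingularities.Theses.ShadowGame.<Decl> := …` in Summits/ResolutionOfSingularities/ResolutionOfSingularities/Theorems/<Name>.lean.
-/

namespace Summit.ResolutionOfSingularities.ResolutionOfSingularities.Theses.ShadowGame

open scoped BigOperators Topology Manifold Classical MeasureTheory ProbabilityTheory Matrix InnerProductSpace ComplexConjugate ContinuousMap
open Filter Set Function TopologicalSpace MeasureTheory

attribute [summit_statement] _root_.ResolutionOfSingularities

/-- item stmt-ResolutionOfSingularities-16158 · target · rank 0 · open · by planner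
why it might fail: It is Temkin2013 Rem 1.3.5's 'uniformize valuations on α_p-torsors over regular schemes', open for dim ≥ 4 in every p (CutkoskyMourtada2019 §1: ELU unknown in dim 4); fails iff LU fails over some perfect field.
sources: Temkin2013, CutkoskyMourtada2019, CossartPiltant2019, Literature.Barriers.ResolutionOfSingularities.DimensionFourFrontier
[target] local uniformization of α_p-torsors over bases regular at the centre, over PERFECT ground
fields: k perfect of char p, K/k, O a valuation ring of K, A₀ ⊆ O f.g. regular at the centre, t ∈ K
with t^p ∈ A₀ and Frac(A₀[t]) = K ⇒ some f.g. A with A₀[t] ⊆ A ⊆ O, Frac A = K, A regular at the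
centre (Valuative's LuAlphaPTorsor, stmt-0641, with [PerfectField k] added). Derived in `closes` as
WinToTorsorLU applied to ShadowGameWin. -/
@[route_item "route-ResolutionOfSingularities-ShadowGame"]
def TorsorLUPerfect : Prop :=
  ∀ p : ℕ, p.Prime → ∀ (k K : Type) [Field k] [CharP k p] [PerfectField k] [Field K] [Algebra k K] (O : ValuationSubring K) (A₀ : Subalgebra k K) (h₀ : A₀.toSubring ≤ O.toSubring) (t : K), A₀.FG → t ^ p ∈ A₀ → IsFractionRing (Algebra.adjoin k (insert t (A₀ : Set K))) K → IsRegularLocalRing (Localization.AtPrime (Ideal.comap (Subring.inclusion h₀) (IsLocalRing.maximalIdeal O))) → ∃ (A : Subalgebra k K) (h : A.toSubring ≤ O.toSubring), A₀ ≤ A ∧ t ∈ A ∧ A.FG ∧ IsFractionRing A K ∧ IsRegularLocalRing (Localization.AtPrime (Ideal.comap (Subring.inclusion h) (IsLocalRing.maximalIdeal O)))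

/-- item stmt-ResolutionOfSingularities-18182 · crux · rank 2 · closed · refuted by Summit.ResolutionOfSingularities.ResolutionOfSingularities.Theorems.not_ShadowGameWinR @ a3edb04da008 (prover) · by planner
why it might fail: A reads only shadows in B's coordinates: at n = 3 B may hide which stratum is due (Spivakovsky1982-type B-win re-run against the new whistle); at n = 2 a B-arc might keep da divisor-free and degenerate for ever; n ≥ 4: realisable kangaroo cycles (HauserPerlega2019).
sources: Spivakovsky1982, HauserWagner2014, arXiv:1403.6789, Giraud1983, Giraud1983Jung, HauserPerlega2019
[crux] THE CERTIFICATE, REPAIRED (rev 3 = rev-2 ShadowGameWin with the refuters' R1 whistle). For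
every prime p and n ≥ 1 there is a strategy strat (input: the list of shadows seen so far and the
list of charts B chose; output: a non-empty F ⊆ {1..n}) such that for every perfect field κ of char
p, every start series c₀ : ℕ^n → κ, every chart sequence i and translation sequence t of B, the play
c_{m+1} = clean(translate_{t m}(divide_{i m}(blowup_{F_m, i m}(clean c_m)))) with F_m =
strat(history) reaches a TERMINAL′ series at some finite stage whenever B always plays i m ∈ F_m;
blowup/divide/translate/clean/shadow verbatim as in rev 2 (blowup_{F,i}: u_j ↦ u_i u_j for j ∈ F∖i;
divide_i by u_i^(p⌊m_F/p⌋); translate u_j ↦ u_j + τ_j on F∖i with Lucas binomials; clean deletes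
exponents in pℕ^n). TERMINAL′(c): clean c = 0, or clean c has a monomial of degree ≤ 1, or a unique
minimal exponent, OR there are w : Fin n → κ⟦u⟧ with Ideal.span(range w) = the maximal ideal of κ⟦u⟧
(a formal regular system of parameters), A : Fin n → ℕ with some p ∤ A_j, a unit v and a series g of
κ⟦u⟧ with clean c = (∏ w_j^{A_j})·v + g^p coefficientwise. Every tree witness against rev 2
(u·(v−φ(u))^p along any ar -/
@[route_item "route-ResolutionOfSingularities-ShadowGame", crux]
def ShadowGameWinR : Prop :=
  ∀ p : ℕ, p.Prime → ∀ n : ℕ, 0 < n → ∃ strat : List (Set (Fin n → ℚ)) → List (Fin n) → Finset (Fin n), (∀ hs js, (strat hs js).Nonempty) ∧ ∀ (κ : Type) [Field κ] [CharP κ p] [PerfectField κ] (c₀ : (Fin n → ℕ) → κ) (i : ℕ → Fin n) (t : ℕ → Fin n → κ), let clean : ((Fin n → ℕ) → κ) → ((Fin n → ℕ) → κ) := fun c A => @ite κ (∀ j, p ∣ A j) (Classical.dec _) 0 (c A); let bl : Finset (Fin n) → Fin n → ((Fin n → ℕ) → κ) → ((Fin n → ℕ) → κ) := fun F i c B =>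 @ite κ (Finset.sum (F.erase i) (fun j => B j) ≤ B i) (Classical.dec _) (c (Function.update B i (B i - Finset.sum (F.erase i) (fun j => B j)))) 0; let mF : Finset (Fin n) → ((Fin n → ℕ) → κ) → ℕ := fun F c => sInf {m : ℕ | ∃ A, c A ≠ 0 ∧ m = Finset.sum F (fun j => A j)}; let dv : Fin n → ℕ → ((Fin n → ℕ) → κ) → ((Fin n → ℕ) → κ) := fun i s c B => c (Function.update B i (B i + s)); let tr : Finset (Fin n) → Fin n → (Fin n → κ) → ℕ → ((Fin n → ℕ) → κ) → ((Fin n → ℕ) → κ) := fun F i τ s c B => Finset.sum (Fintype.piFinset (fun _ : Fin n => Finset.range (B i + s + 1))) (fun D => @ite κ (∀ j, j ∉ F.erase i → D j = 0) (Classical.dec _) (c (B + D) * Finset.prod (F.erase i) (fun j => ((Nat.choose (B j + D j) (B j) : ℕ) : κ) * τ j ^ (D j))) 0); let step : Finset (Fin n) → Fin n → (Fin n → κ) → ((Fin n → ℕ) → κ) → ((Fin n → ℕ) → κ) := fun F i τ c => clean (tr F i τ (p * (mF F (clean c) / p)) (dv i (p * (mF F (clean c) / p)) (bl F i (clean c))));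 let shadow : ((Fin n → ℕ) → κ) → Set (Fin n → ℚ) := fun c => convexHull ℚ {x : Fin n → ℚ | ∃ A, clean c A ≠ 0 ∧ ∀ j, ((A j : ℚ) / p) ≤ x j}; let Terminal : ((Fin n → ℕ) → κ) → Prop := fun c => (∀ A, clean c A = 0) ∨ (∃ A, clean c A ≠ 0 ∧ (Finset.sum Finset.univ (fun j => A j) ≤ 1 ∨ ∀ B, clean c B ≠ 0 → ∀ j, A j ≤ B j)) ∨ ∃ (w : Fin n → MvPowerSeries (Fin n) κ) (A : Fin n → ℕ) (v g : MvPowerSeries (Fin n) κ), Ideal.span (Set.range w) = IsLocalRing.maximalIdeal (MvPowerSeries (Fin n) κ) ∧ (∃ j, ¬ p ∣ A j) ∧ IsUnit v ∧ ∀ B : Fin n →₀ ℕ, clean c ⇑B = MvPowerSeries.coeff B (Finset.prod Finset.univ (fun j => w j ^ A j) * v + g ^ p); let play : ℕ → (((Fin n → ℕ) → κ) × List (Set (Fin n → ℚ)) × List (Fin n)) := fun m => @Nat.rec (fun _ => ((Fin n → ℕ) → κ) × List (Set (Fin n → ℚ)) × List (Fin n)) (c₀, [shadow c₀], ([] : List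 (Fin n))) (fun m st => (step (strat st.2.1 st.2.2) (i m) (t m) st.1, st.2.1 ++ [shadow (step (strat st.2.1 st.2.2) (i m) (t m) st.1)], st.2.2 ++ [i m])) m; (∀ m, i m ∈ strat (play m).2.1 (play m).2.2) → ∃ m, Terminal (play m).1

/-- item stmt-ResolutionOfSingularities-18185 · crux · rank 3 · closed · proved by Summit.ResolutionOfSingularities.ResolutionOfSingularities.Theorems.WinToTorsorLUR.WinToTorsorLUR_proof @ e4dbfcc97aa3 (prover) · by planner
why it might fail: The whistle's formal coordinates must be algebraised: Artin approximation gives only ÉTALE-local toric structure (conjugate formal branches through the centre, node-type cofactors), and the étale-toroidal log-blow-up endgame over non-closed residue fields may leak, forcing a stricter terminal′.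
sources: Artin1969, Kato1994, Niziol2006, Spivakovsky1982, Hironaka1967, CossartJannsenSaito2020
[crux] SOUNDNESS + ENDGAME for the repaired game: ShadowGameWinR ⇒ TorsorLUPerfect. Dictionary as in
rev 2 (reduce to zero-dimensional valuations centred at a REGULAR closed point of V(centre) —
Reg(A₀) open, Jacobson; residue fields algebraic over the perfect k hence perfect; Cohen coefficient
fields containing k unique and compatible along the separable residue tower, all embedded in one
algebraic closure κ; the expansion of a = t^p in exceptional-adapted parameters evolves exactly by
`step`: blow up (u_F) on a f.g. model after inverting a unit of O, divide Z by u_i^k inside O,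
translate by Teichmüller lifts; formal vs algebraic parameters differ by units, preserving shadows
and the three old clauses). NEW endgame input: a terminal′ position clean a = w^A·v + g^p with w
FORMAL parameters over κ ⊇ residue field is algebraised — strong approximation descends it to the
completed strict henselisation, Artin approximation (Artin1969) to an étale neighbourhood of the
centre where a ≡ w′^A v′ mod p-th powers with w′ an algebraic regular system of parameters;
absorbing the unit (p ∤ A_j) makes Z^p = a étale-locally the toric Z^p = w′^A, and LU along the
valuation follows by log blow-ups -/
@[route_item "route-ResolutionOfSingularities-ShadowGame", crux]
def WinToTorsorLUR : Prop :=
  ShadowGameWinR → TorsorLUPerfect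

/-- item stmt-ResolutionOfSingularities-16161 · crux · rank 4 · open · by planner
why it might fail: Patching LUs into one proper regular model is known only in dim ≤ 3 (Zariski; CossartPiltant2008 Prop 4.9 / Piltant2013 need embedded resolution one dimension down); in dim ≥ 4 no reduction Res ⇐ LU exists even in char 0 (CutkoskyMourtada2019 p.3); plain relative LU may be too weak an input.
sources: CutkoskyMourtada2019, Temkin2013, CossartPiltant2019, NovacoskiSpivakovsky2014, Literature.Barriers.ResolutionOfSingularities.DimensionFourFrontier
[crux] Zariski patching over PERFECT ground fields: for every prime p, relative local uniformization
(every f.g. R ⊆ O is dominated by a f.g. A ⊆ O with Frac A = K, regular at the centre) for all f.g.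
K/k with k perfect of char p implies that every reduced separated scheme of finite type over every
perfect field of char p has a resolution. Fibrewise identical to Valuative's PatchingRel (stmt-0642)
restricted to perfect k — one patching argument proves both. [difficulty: open-problem] -/
@[route_item "route-ResolutionOfSingularities-ShadowGame", crux]
def PatchingRelPerfect : Prop :=
  ∀ p : ℕ, p.Prime → (∀ (k K : Type) [Field k] [CharP k p] [PerfectField k] [Field K] [Algebra k K], (⊤ : IntermediateField k K).FG → ∀ O : ValuationSubring K, (∀ c : k, algebraMap k K c ∈ O) → ∀ R : Subalgebra k K, R.FG → R.toSubring ≤ O.toSubring → ∃ (A : Subalgebra k K) (h : A.toSubring ≤ O.toSubring), R ≤ A ∧ A.FG ∧ IsFractionRing A K ∧ IsRegularLocalRing (Localization.AtPrime (Ideal.comap (Subring.inclusion h) (IsLocalRing.maximalIdeal O)))) → ∀ (k : Type) [Field k] [CharP k p] [PerfectField k] (X : AlgebraicGeometry.Scheme.{0}) (f : X ⟶ AlgebraicGeometry.Spec (.of k)), AlgebraicGeometry.IsSeparated f → AlgebraicGeometry.LocallyOfFiniteType f → AlgebraicGeometry.QuasiCompact f → AlgebraicGeometry.IsReduced X → Literature.AlgebraicGeometry.Resolution.Scheme.HasResolution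 X

/-- item stmt-ResolutionOfSingularities-16162 · crux · rank 5 · open · by planner
why it might fail: Rests on Temkin2013 Thm 1.3.2 (vendored fact with an unproved leaf in tree: Temkin2013RelativeCurveSmoothFibre) and on Temkin's model dominating the GIVEN R, which needs his relative form; smooth ≠ regular bookkeeping at each tower step.
sources: Temkin2013, arXiv:0804.1554, Literature.AlgebraicGeometry.Resolution.Temkin2013Relative, Literature.Barriers.ResolutionOfSingularities.InseparableBaseChange
[crux] Temkin's inseparable reduction over PERFECT ground fields: for every prime p, LU of
α_p-torsors over bases regular at the centre (TorsorLUPerfect at p) implies relative LU for every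
f.g. K/k, k perfect of char p (Temkin2013 Thm 1.3.2: after a finite purely inseparable L/K an affine
model is uniformized with smooth centre; Frobenius F^n moves it into K (k perfect, so k^{p^n} = k
and the transport is finite); the tower K₀ ⊂ … ⊂ K of degree-p radical steps is climbed by the
torsor crux). Valuative's TorsorToLurel (stmt-10968) is the all-k version. [difficulty: L] -/
@[route_item "route-ResolutionOfSingularities-ShadowGame", crux]
def TorsorToLurelPerfect : Prop :=
  ∀ p : ℕ, p.Prime → (∀ (k K : Type) [Field k] [CharP k p] [PerfectField k] [Field K] [Algebra k K] (O : ValuationSubring K) (A₀ : Subalgebra k K) (h₀ : A₀.toSubring ≤ O.toSubring) (t : K), A₀.FG → t ^ p ∈ A₀ → IsFractionRing (Algebra.adjoin k (insert t (A₀ : Set K))) K → IsRegularLocalRing (Localization.AtPrime (Ideal.comap (Subring.inclusion h₀) (IsLocalRing.maximalIdeal O))) → ∃ (A : Subalgebra k K) (h : A.toSubring ≤ O.toSubring), A₀ ≤ A ∧ t ∈ A ∧ A.FG ∧ IsFractionRing A K ∧ IsRegularLocalRing (Localization.AtPrime (Ideal.comap (Subring.inclusion h) (IsLocalRing.maximalIdeal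 O)))) → ∀ (k K : Type) [Field k] [CharP k p] [PerfectField k] [Field K] [Algebra k K], (⊤ : IntermediateField k K).FG → ∀ O : ValuationSubring K, (∀ c : k, algebraMap k K c ∈ O) → ∀ R : Subalgebra k K, R.FG → R.toSubring ≤ O.toSubring → ∃ (A : Subalgebra k K) (h : A.toSubring ≤ O.toSubring), R ≤ A ∧ A.FG ∧ IsFractionRing A K ∧ IsRegularLocalRing (Localization.AtPrime (Ideal.comap (Subring.inclusion h) (IsLocalRing.maximalIdeal O)))

/-- item stmt-ResolutionOfSingularities-0549 · crux · rank 6 · open · by planner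
why it might fail: Only known mechanism spreads X over a f.g. field of definition and base-changes a resolution over a perfect subfield back; regular is not geometrically regular under inseparable extension (EGA IV 6.7.4), e.g. k = F_p((t)) (Temkin2008 Question 3.3.3 open).
sources: arXiv:math/0703678, Kollar2007, Literature.Barriers.ResolutionOfSingularities.InseparableBaseChange, Literature.Barriers.ResolutionOfSingularities.RegularNotGeometricallyRegular
PerfectToAll: for a prime p, resolution of all reduced separated finite-type schemes over all
PERFECT fields of char p implies ResolutionInChar p (all fields of char p). Expected inputs:
Neron-Popescu (Stacks 07GC), spreading out, openness of regular locus on excellent schemes;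
regularity is not stable under inseparable ground field extension, which is the difficulty. -/
@[route_item "route-ResolutionOfSingularities-ShadowGame", crux]
def DescentPerfectToAll : Prop :=
  ∀ p : ℕ, p.Prime → (∀ (k : Type) [Field k] [CharP k p] [PerfectField k] (X : AlgebraicGeometry.Scheme.{0}) (f : X ⟶ AlgebraicGeometry.Spec (.of k)), AlgebraicGeometry.IsSeparated f → AlgebraicGeometry.LocallyOfFiniteType f → AlgebraicGeometry.QuasiCompact f → AlgebraicGeometry.IsReduced X → Literature.AlgebraicGeometry.Resolution.Scheme.HasResolution X) → Literature.AlgebraicGeometry.Resolution.ResolutionInChar.{0} p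

-- earlier Assembly (stmt-ResolutionOfSingularities-16163, replaced 2026-08-17T13:32:44Z -> stmt-ResolutionOfSingularities-18184): retired by None — ShadowGameWin → WinToTorsorLU → TorsorToLurelPerfect → PatchingRelPerfect → DescentPerfectToAll → _root_.ResolutionOfSingularities
/-- item stmt-ResolutionOfSingularities-18184 · assembly · rank 1 · closed · moot by None · by planner
sources: Temkin2013, NovacoskiSpivakovsky2014
[assembly] ShadowGameWinR → WinToTorsorLUR → TorsorToLurelPerfect → PatchingRelPerfect →
DescentPerfectToAll → ResolutionOfSingularities. -/
@[route_item "route-ResolutionOfSingularities-ShadowGame"]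
def Assembly : Prop :=
  ShadowGameWinR → WinToTorsorLUR → TorsorToLurelPerfect → PatchingRelPerfect → DescentPerfectToAll → _root_.ResolutionOfSingularities

-- records of items no longer active in this route (dropped / restated):
-- earlier ShadowGameWin (stmt-ResolutionOfSingularities-16159, replaced 2026-08-17T13:32:44Z -> stmt-ResolutionOfSingularities-18182): refuted by Summit.ResolutionOfSingularities.ResolutionOfSingularities.Theorems.ShadowGameShadowGameWin_refuted @ 906734155c3f — ∀ p : ℕ, p.Prime → ∀ n : ℕ, 0 < n → ∃ strat : List (Set (Fin n → ℚ)) → List (Fin n) → Finset (Fin n), (∀ hs js, (strat hs js).Nonempty) ∧ ∀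
-- earlier WinToTorsorLU (stmt-ResolutionOfSingularities-16160, replaced 2026-08-17T13:32:44Z -> stmt-ResolutionOfSingularities-18183): retired by None — ShadowGameWin → TorsorLUPerfect

/-! D-0027 §2.1 — DECIDING THEOREM (planner-authored via `route open/edit --closes-file`; by planner-rfix-ResolutionOfSingularities-Shado-cc874aa9-0 2026-08-17T13:34:54Z) — ARCHIVED: route closed (refuted) 2026-08-20T16:19:00Z; kept so importers keep building:
its hypotheses are this route's items and its conclusion the sub-problem Statement (glue_lint), and it elaborates with this file. -/

@[closes "route-ResolutionOfSingularities-ShadowGame"] theorem closes (hW : ShadowGameWinR) (hS : WinToTorsorLUR) (hT : TorsorToLurelPerfect)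
    (hP : PatchingRelPerfect) (hD : DescentPerfectToAll) : _root_.ResolutionOfSingularities :=
  fun p hp => hD p hp (hP p hp (hT p hp (hS hW p hp)))

end Summit.ResolutionOfSingularities.ResolutionOfSingularities.Theses.ShadowGame
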